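import Summits.AnomalousDissipation.AnomalousDissipation.Theorems.SawtoothPulseCascadeK1LocalisedCascadeFibreDataSharp
import Summits.AnomalousDissipation.AnomalousDissipation.Theorems.SawtoothPulseCascadeK1LocalisedCascadeFibreSocket
import Summits.AnomalousDissipation.AnomalousDissipation.Theorems.SawtoothPulseCascadeK1LocalisedCascadeFibreFactor

/-!
# K1loc, line `Spectral` / SeqCone — helper: THE PER-FIBRE SOCKET FROM PROFILE DATA, SHARP WIENER WEIGHT

Helper file of the prover lane on the crux `K1LocalisedCascade` (stmt-AnomalousDissipation-19491), route
`SawtoothPulseCascade` (variant of `…K1LocalisedCascadeFibreSocket`).  `fibre_estimate_of_profile_data'` = the per-fibre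
un-gauging estimate `hfib` for the true profile on every fibre from fibrewise profile data, with the spectral moments taken
from the one-axis Sobolev–Wiener bound with ONE extra derivative (`…FibreDataSharp`): constants `A = A⋆′(β₀) + A_Q`,
`C = C⋆′(β₀)`, `A⋆′ = Σ_{1≤α<r} B_α(β₀)Cμ_α/(α!(2π)^α) + (Cμ_r/r!)B_{r+1}(β₀)/(2√3(2π)^r)`, `C⋆′ = (CN_r/r!)B_{r+1}(β₀)/(2√3(2π)^r)`
— at `r = 1` only `D₀, D₁, D₂` of the strip cut-off enter (ε-free for the cascade), which is what makes the per-phase constants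
summable (ad-k1loc-p3, STATUS 23:25:58Z).  Reuses `bundleBound_mono`, `estimate_mono` of `…FibreSocket`.
No definitions; no statement about the stub.
[cite: Grafakos2014, Prop. 3.1.2 (5) and Prop. 3.2.7 (3)] [problem: turb]
-/

-- `Summit.<Summit>.<Problem>`: single-conjunct summit, the duplicate namespace segment is deliberate.
set_option linter.dupNamespace false

noncomputable section

namespace Summit.AnomalousDissipation.AnomalousDissipation.Theorems.SawtoothPulseCascade.K1Ledger

open MeasureTheory Set Filter Topology UnitAddTorus Complex
open scoped ComplexConjugate ContDiff Nat
open Literature.Analysis Literature.Analysis.FunctionSpaces Literature.Analysis.FunctionSpaces.Torus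
open Summit.AnomalousDissipation.AnomalousDissipation.Theorems.SawtoothPulseCascade.SpectralLeakage
open Summit.AnomalousDissipation.AnomalousDissipation.Theorems.SawtoothPulseCascade.K1Slot

/-! ## The socket, sharp Wiener weight -/

/-- **The per-fibre estimate for the true profile from profile data — SHARP Wiener weight** (`hfib` of the tracked-family
steps; as `fibre_estimate_of_profile_data` with `…FibreDataSharp.fibre_estimate_one_family_of_fibre_data'`, i.e.
`B_{r+1}(β₀)/(2√3(2π)^r)` in place of `B_{r+2}(β₀)/(12(2π)^r)`).  See the module
docstring for the data; the conclusion is, for every fibre `k_i = n` and every smooth `G` on it,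
`Σ' m²|𝓕((X(x_j)+Z(x_j))·G(Φ_R x))|² ≤ (√Σ' μ²|𝓕G|² + (A⋆(β₀) + A_Q)‖G‖)² + 2C⋆(β₀)‖G‖²`.
[cite: Grafakos2014, Prop. 3.1.2 (5) and Prop. 3.2.7 (3)] -/
theorem fibre_estimate_of_profile_data' {i j : Fin 2} (hij : i ≠ j) (P Q R : ShearProfile) (hR : ∀ y, R y = P y + Q y)
    (X Z : ShearProfile) (hX1 : ∀ y, |X y| ≤ 1) (hZ : ∀ y, Z y = 0)
    {U : Set ℝ} {s : ℝ} (hPU : ∀ y ∈ U, HasDerivAt P s y) (hXU : ∀ y, y ∉ U → (fun y : ℝ => (X y : ℂ)) =ᶠ[𝓝 y] 0)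
    {D : ℕ → ℝ} (hD : ∀ k y, |iteratedDeriv k X y| ≤ D k) {r : ℕ} (hr : 1 ≤ r)
    {m μ : (Fin 2 → ℤ) → ℝ} (hm1 : ∀ k, |m k| ≤ 1) (R₀ : ℝ)
    (hone : ∀ n : ℤ, R₀ ≤ |(n : ℝ)| → ∀ k : Fin 2 → ℤ, k i = n → μ k = 1)
    (b : ℤ → ℤ) {β₀ : ℝ} (hβ0 : 0 ≤ β₀) (hβ : ∀ n : ℤ, |(n : ℝ)| < R₀ → |((b n : ℤ) : ℝ) - n * s| ≤ β₀)
    (Mμ : ℤ → ℝ → ℝ) (hMμc : ∀ n : ℤ, |(n : ℝ)| < R₀ → ContDiff ℝ r (Mμ n))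
    (hμM : ∀ n : ℤ, |(n : ℝ)| < R₀ → ∀ k : Fin 2 → ℤ, k i = n → μ k = Mμ n (k j))
    {Cμ : ℕ → ℝ} (hCμ0 : ∀ α, 0 ≤ Cμ α)
    (hCμ : ∀ n : ℤ, |(n : ℝ)| < R₀ → ∀ α ≤ r, ∀ t, |iteratedDeriv α (Mμ n) t| ≤ Cμ α)
    (mf : ℤ → (Fin 2 → ℤ) → ℝ) (hmf : ∀ (n : ℤ) (k : Fin 2 → ℤ), k i = n → mf n k = m k)
    (hmf1 : ∀ n k, |mf n k| ≤ 1)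
    (N : ℤ → ℝ → ℝ) (hNc : ∀ n : ℤ, |(n : ℝ)| < R₀ → ContDiff ℝ r (N n))
    (hmN : ∀ n : ℤ, |(n : ℝ)| < R₀ → ∀ k : Fin 2 → ℤ, mf n (k - Pi.single j (b n)) ^ 2 = N n (k j))
    {CN : ℕ → ℝ} (hCN0 : ∀ α, 0 ≤ CN α)
    (hCN : ∀ n : ℤ, |(n : ℝ)| < R₀ → ∀ α ≤ r, ∀ t, |iteratedDeriv α (N n) t| ≤ CN α)
    (hcomp : ∀ n : ℤ, |(n : ℝ)| < R₀ → ∀ k : Fin 2 → ℤ, k i = n → m (k - Pi.single j (b n)) ^ 2 ≤ μ k ^ 2)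
    {AQ : ℝ} (hAQ : 0 ≤ AQ)
    (hleak : ∀ n : ℤ, |(n : ℝ)| < R₀ → ∀ G : UnitAddTorus (Fin 2) → ℂ, IsSmooth G →
      (∀ k, mFourierCoeff G k ≠ 0 → k i = n) →
      Real.sqrt (∑' k, μ k ^ 2 * ‖mFourierCoeff (G ∘ shearMap i j Q) k‖ ^ 2) ≤
        Real.sqrt (∑' k, μ k ^ 2 * ‖mFourierCoeff G k‖ ^ 2) + AQ * Real.sqrt (∫ x, ‖G x‖ ^ 2))
    (n : ℤ) (G : UnitAddTorus (Fin 2) → ℂ) (hG : IsSmooth G) (hn : ∀ k, mFourierCoeff G k ≠ 0 → k i = n) :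
    ∑' k, m k ^ 2 * ‖mFourierCoeff (fun x => ((X.onCircle (x j) : ℂ) + Z.onCircle (x j)) * G (shearMap i j R x)) k‖ ^ 2 ≤
      (Real.sqrt (∑' k, μ k ^ 2 * ‖mFourierCoeff G k‖ ^ 2) +
          ((∑ α ∈ Finset.Ico 1 r, (∑ i ∈ Finset.range (α + 1), (α.choose i : ℝ) * (2 * Real.pi * β₀) ^ i * D (α - i)) *
              (Cμ α / ((α ! : ℝ) * (2 * Real.pi) ^ α)) +
            Cμ r / (r ! : ℝ) * ((∑ i ∈ Finset.range (r + 1 + 1), ((r + 1).choose i : ℝ) * (2 * Real.pi * β₀) ^ i *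
              D (r + 1 - i)) / (2 * Real.sqrt 3 * (2 * Real.pi) ^ r))) + AQ) * Real.sqrt (∫ x, ‖G x‖ ^ 2)) ^ 2 +
        2 * (CN r / (r ! : ℝ) * ((∑ i ∈ Finset.range (r + 1 + 1), ((r + 1).choose i : ℝ) * (2 * Real.pi * β₀) ^ i *
            D (r + 1 - i)) / (2 * Real.sqrt 3 * (2 * Real.pi) ^ r))) * ∫ x, ‖G x‖ ^ 2 := by
  -- sign bookkeeping
  have hD0 : ∀ k, 0 ≤ D k := fun k => (abs_nonneg _).trans (hD k 0)
  set Bβ : ℕ → ℝ := fun α => ∑ i ∈ Finset.range (α + 1), (α.choose i : ℝ) * (2 * Real.pi * β₀) ^ i * D (α - i) with hBβ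
  set Astar : ℝ := ∑ α ∈ Finset.Ico 1 r, Bβ α * (Cμ α / ((α ! : ℝ) * (2 * Real.pi) ^ α)) +
    Cμ r / (r ! : ℝ) * (Bβ (r + 1) / (2 * Real.sqrt 3 * (2 * Real.pi) ^ r)) with hAstar
  set Cstar : ℝ := CN r / (r ! : ℝ) * (Bβ (r + 1) / (2 * Real.sqrt 3 * (2 * Real.pi) ^ r)) with hCstar
  -- the cut-off as a torus function
  have hΞc : Continuous fun x : UnitAddTorus (Fin 2) => (X.onCircle (x j) : ℂ) + Z.onCircle (x j) :=
    (continuous_ofReal.comp (isSmooth_onCircle_comp' X j).continuous).add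
      (continuous_ofReal.comp (isSmooth_onCircle_comp' Z j).continuous)
  have hΞ1 : ∀ x : UnitAddTorus (Fin 2), ‖(X.onCircle (x j) : ℂ) + Z.onCircle (x j)‖ ≤ 1 := fun x => by
    obtain ⟨y, hy⟩ := QuotientAddGroup.mk_surjective (x j)
    rw [← hy, ShearProfile.onCircle_coe, ShearProfile.onCircle_coe, hZ, Complex.ofReal_zero, add_zero, Complex.norm_real,
      Real.norm_eq_abs]
    exact hX1 y
  have hBβ0 : ∀ α, 0 ≤ Bβ α := fun α => Finset.sum_nonneg fun i _ => by
    have := hD0 (α - i); have := hβ0; positivity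
  have hA0 : 0 ≤ Astar := by
    refine add_nonneg (Finset.sum_nonneg fun α _ => mul_nonneg (hBβ0 α) (div_nonneg (hCμ0 α) (by positivity))) ?_
    exact mul_nonneg (div_nonneg (hCμ0 r) (by positivity)) (div_nonneg (hBβ0 _) (by positivity))
  have hC0 : 0 ≤ Cstar := mul_nonneg (div_nonneg (hCN0 r) (by positivity)) (div_nonneg (hBβ0 _) (by positivity))
  -- the two cases
  rcases le_or_gt R₀ |(n : ℝ)| with hR₀ | hR₀
  · -- beyond the envelope: the old symbol is `≡ 1` on the fibre
    have h := fibre_estimate_of_symbol_eq_one hij R hΞc hΞ1 hm1 (hone n hR₀) (add_nonneg hA0 hAQ) hC0 hG hn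
    simpa only [hAstar, hCstar, hBβ] using h
  · -- below the envelope: factorise the shear and use the profile data of the fibre
    have hb0 : 0 ≤ |((b n : ℤ) : ℝ) - n * s| := abs_nonneg _
    have hfibP : ∀ G' : UnitAddTorus (Fin 2) → ℂ, IsSmooth G' → (∀ k, mFourierCoeff G' k ≠ 0 → k i = n) →
        ∑' k, m k ^ 2 * ‖mFourierCoeff (fun x => ((X.onCircle (x j) : ℂ) + Z.onCircle (x j)) *
            G' (shearMap i j P x)) k‖ ^ 2 ≤
          (Real.sqrt (∑' k, μ k ^ 2 * ‖mFourierCoeff G' k‖ ^ 2) + Astar * Real.sqrt (∫ x, ‖G' x‖ ^ 2)) ^ 2 +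
            2 * Cstar * ∫ x, ‖G' x‖ ^ 2 := by
      intro G' hG' hn'
      have h := fibre_estimate_one_family_of_fibre_data' hG' hij hn' P X Z hX1 hZ (b n) hPU hXU hD hr (hMμc n hR₀)
        (hμM n hR₀) (hCμ n hR₀) (hmf n) (hmf1 n) (hNc n hR₀) (hmN n hR₀) (hCN n hR₀) (hcomp n hR₀)
      -- monotonicity in the shift defect `|b_n − n s| ≤ β₀`
      have hmono : ∀ α, ∑ i ∈ Finset.range (α + 1), (α.choose i : ℝ) * (2 * Real.pi * |((b n : ℤ) : ℝ) - n * s|) ^ i *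
          D (α - i) ≤ Bβ α := fun α => bundleBound_mono hD0 hb0 (hβ n hR₀) α
      have hAle : ∑ α ∈ Finset.Ico 1 r, (∑ i ∈ Finset.range (α + 1), (α.choose i : ℝ) *
            (2 * Real.pi * |((b n : ℤ) : ℝ) - n * s|) ^ i * D (α - i)) * (Cμ α / ((α ! : ℝ) * (2 * Real.pi) ^ α)) +
          Cμ r / (r ! : ℝ) * ((∑ i ∈ Finset.range (r + 1 + 1), ((r + 1).choose i : ℝ) *
            (2 * Real.pi * |((b n : ℤ) : ℝ) - n * s|) ^ i * D (r + 1 - i)) / (2 * Real.sqrt 3 * (2 * Real.pi) ^ r)) ≤ Astar := by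
        rw [hAstar]
        refine add_le_add (Finset.sum_le_sum fun α _ => mul_le_mul_of_nonneg_right (hmono α)
          (div_nonneg (hCμ0 α) (by positivity))) ?_
        exact mul_le_mul_of_nonneg_left (div_le_div_of_nonneg_right (hmono (r + 1)) (by positivity))
          (div_nonneg (hCμ0 r) (by positivity))
      have hCle : CN r / (r ! : ℝ) * ((∑ i ∈ Finset.range (r + 1 + 1), ((r + 1).choose i : ℝ) *
            (2 * Real.pi * |((b n : ℤ) : ℝ) - n * s|) ^ i * D (r + 1 - i)) / (2 * Real.sqrt 3 * (2 * Real.pi) ^ r)) ≤ Cstar := by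
        rw [hCstar]
        exact mul_le_mul_of_nonneg_left (div_le_div_of_nonneg_right (hmono (r + 1)) (by positivity))
          (div_nonneg (hCN0 r) (by positivity))
      have hAn0 : 0 ≤ ∑ α ∈ Finset.Ico 1 r, (∑ i ∈ Finset.range (α + 1), (α.choose i : ℝ) *
            (2 * Real.pi * |((b n : ℤ) : ℝ) - n * s|) ^ i * D (α - i)) * (Cμ α / ((α ! : ℝ) * (2 * Real.pi) ^ α)) +
          Cμ r / (r ! : ℝ) * ((∑ i ∈ Finset.range (r + 1 + 1), ((r + 1).choose i : ℝ) *
            (2 * Real.pi * |((b n : ℤ) : ℝ) - n * s|) ^ i * D (r + 1 - i)) / (2 * Real.sqrt 3 * (2 * Real.pi) ^ r)) := by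
        refine add_nonneg (Finset.sum_nonneg fun α _ => mul_nonneg (Finset.sum_nonneg fun i _ => ?_)
          (div_nonneg (hCμ0 α) (by positivity))) (mul_nonneg (div_nonneg (hCμ0 r) (by positivity))
          (div_nonneg (Finset.sum_nonneg fun i _ => ?_) (by positivity)))
        · have := hD0 (α - i); positivity
        · have := hD0 (r + 1 - i); positivity
      exact estimate_mono (Real.sqrt_nonneg _) (Real.sqrt_nonneg _) (integral_nonneg fun x => by positivity) hAn0 hAle
        hCle h
    have h := fibre_estimate_of_factor hij P Q R hR (fun x => (X.onCircle (x j) : ℂ) + Z.onCircle (x j)) hA0 hfibP hG hn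
      (hleak n hR₀ G hG hn)
    simpa only [hAstar, hCstar, hBβ] using h

end Summit.AnomalousDissipation.AnomalousDissipation.Theorems.SawtoothPulseCascade.K1Ledger
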